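import Mathlib
import Summits.Ventures.HodgeRepro2.T5FiniteZeros
import Summits.Ventures.HodgeRepro2.T5PadicFiniteOrderCharacters
import Summits.Ventures.HodgeRepro2.T5AmiceTransform

/-!
# T5FiniteZerosCharacters — S5 assembled: a non-zero measure on `ℤ_p` kills only finitely many
continuous characters

Cell pub-hodge-repro2, Tier 5 support (seat p7; route/T5-CHECK-G-p7.md §3 S5). §G's step S5:
«m := L⁻_{Σ,λ⁻¹,𝔭} ≠ 0 … f_m = p^μ·P·U, P distinguished with ≤ deg P zeros in the open disc;
ν ↦ ζ_ν − 1 is injective into the open disc ⇒ |Z_i| < ∞, Z_i := {ν ∈ Ξ_𝔭 : ∫ν dm = 0}».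
The three ingredients are now kernel statements of this cell and compose here:

* p8's `T5FiniteZeros.finite_aevalZeroSet` / `exists_poly_of_ne_zero` (Weierstrass preparation,
  Mathlib's `PowerSeries.exists_isWeierstrassFactorization`): for `f ≠ 0` over a complete linearly
  topologised DVR, the evaluation points `a` with `f(a) = 0` are finitely many, all roots of a non-zero
  polynomial `P`;
* `T5AmiceTransform`: `f_m := amice m ≠ 0` for `m ≠ 0`, and `∫κ dm = f_m(κ 1 − 1)` (`aeval_amice_eq_map`);
* `T5PadicFiniteOrderCharacters.eval_one_sub_one_injective`: `κ ↦ κ 1 − 1` is injective.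

Hence `finite_zeroSet_addChar`: `{κ continuous : ∫κ dm = 0}` is finite; a fortiori on the finite-order
characters `Ξ_𝔭` (`finite_zeroSet_finiteOrder`), `∫κ dm ≠ 0` for all but finitely many `κ`
(`eventually_cofinite_map_ne_zero`), and the count `#{κ : ∫κ dm = 0} ≤ deg P` — S5's «|Z_i| ≤ deg P_i»
(`exists_ncard_zeroSet_le_natDegree`). The model instance `R = ℤ_[p]` satisfies every hypothesis
(T5PadicLinearTopology; the `example` is recorded in T5PushforwardMeasure). What the prose still
supplies: that the Katz measure is such an `m ≠ 0` (S4) — here `m` is any non-zero continuous functional.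
-/

namespace Summit.Ventures.HodgeRepro2.T5FiniteZerosCharacters

open PadicInt Filter Topology
open Summit.Ventures.HodgeRepro2

section AevalX

variable {S : Type*} [CommRing S] [UniformSpace S] [IsUniformAddGroup S] [IsTopologicalRing S]
  [T2Space S] [CompleteSpace S] [IsLinearTopology S S]

/-- Mathlib's evaluation sends `X` to the evaluation point. -/
theorem aeval_X_eq {a : S} (ha : PowerSeries.HasEval a) :
    PowerSeries.aeval ha (PowerSeries.X : PowerSeries S) = a := by
  rw [← Polynomial.coe_X, PowerSeries.aeval_coe, Polynomial.aeval_X]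

end AevalX

variable {p : ℕ} [hp : Fact p.Prime]
variable {R : Type*} [NormedCommRing R] [Algebra ℤ_[p] R] [IsBoundedSMul ℤ_[p] R]
  [IsUltrametricDist R] [CompleteSpace R] [IsLinearTopology R R] [IsDomain R]
  [IsDiscreteValuationRing R] [IsAdicComplete (IsLocalRing.maximalIdeal R) R]

/-- The zero set of `f_m` on evaluation points is finite when `m ≠ 0`
(p8's Weierstrass statement applied to the Amice transform). -/
theorem finite_aevalZeroSet_amice (m : C(ℤ_[p], R) →ₗ[R] R) (hm : Continuous m) (hne : m ≠ 0) :
    {a : R | ∃ ha : PowerSeries.HasEval a, PowerSeries.aeval ha (T5AmiceTransform.amice m) = 0}.Finite :=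
  T5FiniteZeros.finite_aevalZeroSet ((T5AmiceTransform.amice_ne_zero_iff m hm).mpr hne)

/-- S5 ASSEMBLED: a non-zero continuous functional `m` on `C(ℤ_p, R)` vanishes on only finitely many
continuous characters `κ` of `ℤ_p` — `{κ : ∫κ dm = 0}` is finite. -/
theorem finite_zeroSet_addChar (m : C(ℤ_[p], R) →ₗ[R] R) (hm : Continuous m) (hne : m ≠ 0) :
    {κ : {κ : AddChar ℤ_[p] R // Continuous κ} | m ⟨κ.1, κ.2⟩ = 0}.Finite := by
  refine ((finite_aevalZeroSet_amice m hm hne).preimage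
    (T5PadicFiniteOrderCharacters.eval_one_sub_one_injective.injOn)).subset ?_
  intro κ hκ
  simp only [Set.mem_setOf_eq] at hκ
  refine ⟨T5AmiceTransform.hasEval_eval_one_sub_one κ.1 κ.2, ?_⟩
  rw [T5AmiceTransform.aeval_amice_eq_map m hm κ.1 κ.2]
  exact hκ

/-- S5 on `Ξ_𝔭`: only finitely many finite-order continuous characters are killed by `m ≠ 0`
(`Z_i := {ν ∈ Ξ_𝔭 : ∫ν dm = 0}` is finite). -/
theorem finite_zeroSet_finiteOrder (m : C(ℤ_[p], R) →ₗ[R] R) (hm : Continuous m) (hne : m ≠ 0) :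
    {κ : {κ : AddChar ℤ_[p] R // Continuous κ} |
      (∃ k : ℕ, ∀ x : ℤ_[p], κ.1 x ^ (p ^ k) = 1) ∧ m ⟨κ.1, κ.2⟩ = 0}.Finite :=
  (finite_zeroSet_addChar m hm hne).subset fun _ h => h.2

/-- `∫κ dm ≠ 0` for all but finitely many continuous characters `κ` (cofinite form of S5). -/
theorem eventually_cofinite_map_ne_zero (m : C(ℤ_[p], R) →ₗ[R] R) (hm : Continuous m) (hne : m ≠ 0) :
    ∀ᶠ κ : {κ : AddChar ℤ_[p] R // Continuous κ} in cofinite, m ⟨κ.1, κ.2⟩ ≠ 0 := by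
  rw [Filter.eventually_cofinite]
  simpa only [not_not] using finite_zeroSet_addChar m hm hne

/-- The zero set is finite as a set of characters (without the continuity bundling): the set of
continuous characters `κ` with `m κ = 0` is finite. -/
theorem finite_setOf_continuous_and_map_eq_zero (m : C(ℤ_[p], R) →ₗ[R] R) (hm : Continuous m)
    (hne : m ≠ 0) :
    {κ : AddChar ℤ_[p] R | ∃ hκ : Continuous κ, m ⟨κ, hκ⟩ = 0}.Finite := by
  have h := (finite_zeroSet_addChar m hm hne).image Subtype.val
  refine h.subset ?_
  rintro κ ⟨hκ, hκ0⟩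
  exact ⟨⟨κ, hκ⟩, hκ0, rfl⟩


/-- S5's COUNT «|Z_i| ≤ deg P_i»: there is a non-zero polynomial `P` (p8's Weierstrass polynomial of
`f_m`) such that every continuous character killed by `m` has `κ 1 − 1` among its roots; hence
`#{κ : ∫κ dm = 0} ≤ deg P`. -/
theorem exists_ncard_zeroSet_le_natDegree (m : C(ℤ_[p], R) →ₗ[R] R) (hm : Continuous m) (hne : m ≠ 0) :
    ∃ P : Polynomial R, P ≠ 0 ∧
      {κ : {κ : AddChar ℤ_[p] R // Continuous κ} | m ⟨κ.1, κ.2⟩ = 0}.ncard ≤ P.natDegree := by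
  obtain ⟨P, hP0, hP⟩ :=
    T5FiniteZeros.exists_poly_of_ne_zero ((T5AmiceTransform.amice_ne_zero_iff m hm).mpr hne)
  refine ⟨P, hP0, ?_⟩
  classical
  have hsub : ∀ κ ∈ {κ : {κ : AddChar ℤ_[p] R // Continuous κ} | m ⟨κ.1, κ.2⟩ = 0},
      κ.1 1 - 1 ∈ (↑P.roots.toFinset : Set R) := by
    intro κ hκ
    simp only [Set.mem_setOf_eq] at hκ
    rw [Finset.mem_coe, Multiset.mem_toFinset, Polynomial.mem_roots hP0]
    have h := hP (PowerSeries.aeval (T5AmiceTransform.hasEval_eval_one_sub_one κ.1 κ.2))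
      (by rw [T5AmiceTransform.aeval_amice_eq_map m hm κ.1 κ.2]; exact hκ)
    rwa [aeval_X_eq] at h
  calc {κ : {κ : AddChar ℤ_[p] R // Continuous κ} | m ⟨κ.1, κ.2⟩ = 0}.ncard
      ≤ (↑P.roots.toFinset : Set R).ncard :=
        Set.ncard_le_ncard_of_injOn _ hsub
          (T5PadicFiniteOrderCharacters.eval_one_sub_one_injective.injOn) (Finset.finite_toSet _)
    _ = P.roots.toFinset.card := Set.ncard_coe_finset _
    _ ≤ P.roots.card := Multiset.toFinset_card_le _
    _ ≤ P.natDegree := Polynomial.card_roots' P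

end Summit.Ventures.HodgeRepro2.T5FiniteZerosCharacters
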